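import Summits.BirchSwinnertonDyer.BirchSwinnertonDyer.Theorems.ClassRecordThreeEulerHalvesAtThreeCartanCoverDockedLineSaturation
import Summits.BirchSwinnertonDyer.BirchSwinnertonDyer.Theorems.ClassRecordThreeEulerHalvesAtThreeCartanCoverStrongApprox
import HarnessLib

/-!
# (D4) from (M) and the Galois leaf alone — crux `CartanOnePlaceDegreeLawAtThree` (NUM, stmt-BirchSwinnertonDyer-24801), lines `lattice` ∕ `charext`

With (M0) PROVED at odd Cartan places (`CoverReduction.redHom_surjective_of_odd`, lead tam3-p1 g27), the docked-line residual (DLS) needs only (EXT)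
(a theorem, `Charext.invariantHomExtendsSL2`) and the Galois leaf (OBS): `dockedLineSaturation_of_ext_of_noExtension`, via the LOCAL form
`exists_modThree_extension_local` of the extension step (same proof as `exists_modThree_extension`, cruxidea-24801-1 g0, with the surjectivity of
`redHom` at the one place in play as its hypothesis). COMPOSITION: **`saturationAtThree_of_character_of_noExtension :
CartanCover.PeriodLatticeCharacter → NoModThreePeriodCharacterExtension → CartanCover.SaturationAtThree`** — the content node (D4) of the crux is
ONE print fact (M) plus ONE Galois statement (OBS). BSD is proved for no curve. [cite: KohenPacetti2016, Rem. 3.8 (arXiv:1403.7801v3 p. 15)]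
-/

set_option linter.dupNamespace false
set_option autoImplicit false

noncomputable section

open scoped Classical Pointwise MatrixGroups UpperHalfPlane

namespace Summit.BirchSwinnertonDyer.BirchSwinnertonDyer.Theorems.CartanCover.Charext

open Summit.BirchSwinnertonDyer.BirchSwinnertonDyer.Theorems
open Literature.NumberTheory.Automorphic WeierstrassCurve Literature.NumberTheory.EllipticCurves.Rank1Residual
  Summit.BirchSwinnertonDyer.Rank1Residual

section D3Lemmas

variable {Γ : Subgroup (GL (Fin 2) ℝ)} [Γ.HasDetOne]

/-- Elements of `Γ ≤ SL₂(ℝ)` have positive determinant.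
-- adapted from Literature/NumberTheory/Automorphic/ShimuraCurvePeriodsHeckeIntegralityProofs.lean §2 (no hub olean in this closure) [folklore] -/
private theorem det_val_pos_of_mem_loc {γ : GL (Fin 2) ℝ} (hγ : γ ∈ Γ) : 0 < γ.det.val := by
  rw [Subgroup.HasDetOne.det_eq hγ, Units.val_one]; exact one_pos

/-- `Γ`-invariance of segment integrals: `∫_{γz}^{γw} h = ∫_z^w h`. [folklore] -/
private theorem segmentIntegral_smul_smul_loc (h : CuspForm Γ 2) {γ : GL (Fin 2) ℝ} (hγ : γ ∈ Γ) (z w : ℍ) :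
    segmentIntegral h (γ • z) (γ • w) = segmentIntegral h z w := by
  have e := CartanDegree.segmentIntegral_slash_inv_smul h (det_val_pos_of_mem_loc hγ) (γ • z) w
  rw [SlashInvariantForm.slash_action_eqn h γ hγ, inv_smul_smul] at e
  exact e.symm

/-- The period `∫_τ^{γτ} h` does not depend on the base point. [folklore] -/
private theorem period_eq_period_loc (h : CuspForm Γ 2) {γ : GL (Fin 2) ℝ} (hγ : γ ∈ Γ) (z w : ℍ) :
    segmentIntegral h z (γ • z) = segmentIntegral h w (γ • w) := by
  have e1 := segmentIntegral_sub_segmentIntegral h w z (γ • z)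
  have e2 := segmentIntegral_sub_segmentIntegral h w (γ • w) (γ • z)
  have e3 := segmentIntegral_smul_smul_loc h hγ w z
  linear_combination (-1 : ℂ) * e1 + e2 + e3

omit [Γ.HasDetOne] in
/-- `∫_z^z h = 0`. [folklore] -/
private theorem period_one_loc (h : CuspForm Γ 2) (z : ℍ) : segmentIntegral h z ((1 : GL (Fin 2) ℝ) • z) = 0 := by
  have e := segmentIntegral_sub_segmentIntegral h z z z
  rw [sub_self] at e
  rw [one_smul]
  exact e.symm

/-- Additivity of periods: `γ ↦ ∫_z^{γz} h` is a homomorphism on `Γ`. [folklore] -/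
private theorem period_mul_loc (h : CuspForm Γ 2) {γ : GL (Fin 2) ℝ} (hγ : γ ∈ Γ) (δ : GL (Fin 2) ℝ) (z : ℍ) :
    segmentIntegral h z ((γ * δ) • z) = segmentIntegral h z (γ • z) + segmentIntegral h z (δ • z) := by
  have e1 := segmentIntegral_sub_segmentIntegral h z (δ • z) ((γ * δ) • z)
  have e2 : segmentIntegral h (δ • z) ((γ * δ) • z) = segmentIntegral h z (γ • z) := by
    rw [mul_smul]; exact (period_eq_period_loc h hγ z (δ • z)).symm
  linear_combination e1 + e2


end D3Lemmas

section DLSLocal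

variable {D M : ℕ} {C : Finset ℕ} {X : CartanLevelCurveData D M C} {q : ℕ}
variable [Fact q.Prime] (R : CartanCover.CoverReduction X q) {W₁ : WeierstrassCurve ℚ}

include R in
/-- Steps 3–4, LOCAL form (surjectivity of `redHom` at THIS place as the hypothesis `hM0q`): (EXT) in `Λ ∕ 3Λ`-coordinates — a `Λ`-valued function on `Γ̄(q)`, additive and `ι(O₀'¹)`-conjugation-invariant modulo `3Λ`,
extends modulo `3Λ` to a `Λ`-valued quasi-homomorphism on `ι(O₀'¹) = coverUnits X q`. [folklore] -/
theorem exists_modThree_extension_local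
    (hM0q : ∀ g : GL (Fin 2) (ZMod q), Matrix.det (g : Matrix (Fin 2) (Fin 2) (ZMod q)) = 1 → ∃ γ : CartanCover.coverUnits X q, R.redHom γ = g)
    (hE : InvariantHomExtendsSL2)
    (hq : q ∈ C) (hq1 : q % 3 = 1) (Λ : Submodule ℤ ℂ) (ψ : GL (Fin 2) ℝ → ℂ)
    (hψΛ : ∀ β ∈ CartanCover.principalLevel X q, ψ β ∈ Λ)
    (hψadd : ∀ β₁ ∈ CartanCover.principalLevel X q, ∀ β₂ ∈ CartanCover.principalLevel X q, ψ (β₁ * β₂) = ψ β₁ + ψ β₂)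
    (hψconj : ∀ γ ∈ CartanCover.coverUnits X q, ∀ β ∈ CartanCover.principalLevel X q, ∃ y ∈ Λ, ψ (γ * β * γ⁻¹) - ψ β = 3 * y) :
    ∃ χ : GL (Fin 2) ℝ → ℂ,
      (∀ γ ∈ CartanCover.coverUnits X q, χ γ ∈ Λ) ∧
      (∀ γ ∈ CartanCover.coverUnits X q, ∀ δ ∈ CartanCover.coverUnits X q, ∃ y ∈ Λ, χ (γ * δ) - χ γ - χ δ = 3 * y) ∧
      (∀ β ∈ CartanCover.principalLevel X q, ∃ y ∈ Λ, χ β - ψ β = 3 * y) := by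
  -- the 3-torsion module `A = Λ ∕ 3Λ`
  obtain ⟨p3, hp3⟩ : ∃ p3 : Submodule ℤ Λ, ∀ x : Λ, x ∈ p3 ↔ ∃ y : Λ, (3 : ℤ) • y = x :=
    ⟨LinearMap.range ((3 : ℤ) • (LinearMap.id : Λ →ₗ[ℤ] Λ)), fun x => by
      simp only [LinearMap.mem_range, LinearMap.smul_apply, LinearMap.id_coe, id_eq]⟩
  have h3A : ∀ a : Λ ⧸ p3, (3 : ℤ) • a = 0 := by
    intro a
    obtain ⟨x, rfl⟩ := Submodule.Quotient.mk_surjective p3 a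
    have e : Submodule.Quotient.mk (p := p3) ((3 : ℤ) • x) = (3 : ℤ) • Submodule.Quotient.mk (p := p3) x :=
      Submodule.Quotient.mk_smul p3 (3 : ℤ) x
    rw [← e, Submodule.Quotient.mk_eq_zero, hp3]
    exact ⟨x, rfl⟩
  obtain ⟨χA, hχA⟩ : ∃ χA : CartanCover.coverUnits X q → Λ ⧸ p3, ∀ (γ : CartanCover.coverUnits X q)
      (h : (γ : GL (Fin 2) ℝ) ∈ CartanCover.principalLevel X q), χA γ = Submodule.Quotient.mk ⟨ψ γ, hψΛ γ h⟩ :=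
    ⟨fun γ => if h : (γ : GL (Fin 2) ℝ) ∈ CartanCover.principalLevel X q then Submodule.Quotient.mk ⟨ψ γ, hψΛ γ h⟩ else 0,
      fun γ h => dif_pos h⟩
  have himg : ∀ g : GL (Fin 2) (ZMod q), (∃ γ, R.redHom γ = g) ↔ Matrix.det (g : Matrix (Fin 2) (Fin 2) (ZMod q)) = 1 := by
    intro g; constructor
    · rintro ⟨γ, rfl⟩; exact R.det_redHom γ
    · exact hM0q g
  have hker : ∀ β : CartanCover.coverUnits X q, R.redHom β = 1 ↔ (β : GL (Fin 2) ℝ) ∈ CartanCover.principalLevel X q :=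
    fun β => R.mem_ker_redHom_iff β
  have hadd : ∀ β₁ β₂ : CartanCover.coverUnits X q, R.redHom β₁ = 1 → R.redHom β₂ = 1 → χA (β₁ * β₂) = χA β₁ + χA β₂ := by
    intro β₁ β₂ h₁ h₂
    have h₁' := (hker β₁).mp h₁
    have h₂' := (hker β₂).mp h₂
    have h₁₂ : ((β₁ * β₂ : CartanCover.coverUnits X q) : GL (Fin 2) ℝ) ∈ CartanCover.principalLevel X q := by
      rw [Subgroup.coe_mul]; exact (CartanCover.principalLevel X q).mul_mem h₁' h₂'
    rw [hχA _ h₁', hχA _ h₂', hχA _ h₁₂, ← Submodule.Quotient.mk_add]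
    congr 1
    apply Subtype.ext
    show ψ ((β₁ * β₂ : CartanCover.coverUnits X q) : GL (Fin 2) ℝ) = ψ β₁ + ψ β₂
    rw [Subgroup.coe_mul]
    exact hψadd _ h₁' _ h₂'
  have hconjA : ∀ γ β : CartanCover.coverUnits X q, R.redHom β = 1 → χA (γ * β * γ⁻¹) = χA β := by
    intro γ β hβ
    have hβ' := (hker β).mp hβ
    have hc' : ((γ * β * γ⁻¹ : CartanCover.coverUnits X q) : GL (Fin 2) ℝ) ∈ CartanCover.principalLevel X q := by
      rw [Subgroup.coe_mul, Subgroup.coe_mul, Subgroup.coe_inv]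
      exact CartanCover.conj_mem_principalLevel X q γ.2 hβ'
    rw [hχA _ hβ', hχA _ hc', Submodule.Quotient.eq p3, hp3]
    obtain ⟨y, hy, e⟩ := hψconj γ γ.2 β hβ'
    refine ⟨⟨y, hy⟩, Subtype.ext ?_⟩
    show (((3 : ℤ) • (⟨y, hy⟩ : Λ) : Λ) : ℂ) = ψ ((γ * β * γ⁻¹ : CartanCover.coverUnits X q) : GL (Fin 2) ℝ) - ψ β
    rw [Submodule.coe_smul, Subgroup.coe_mul, Subgroup.coe_mul, Subgroup.coe_inv, e, zsmul_eq_mul]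
    push_cast
    ring
  obtain ⟨χ', hχ'add, hχ'res⟩ := hE q hq1 (CartanCover.coverUnits X q) (Λ ⧸ p3) R.redHom χA h3A himg hadd hconjA
  -- lift back to `Λ`
  choose lift hlift using Submodule.Quotient.mk_surjective p3
  refine ⟨fun g => if h : g ∈ CartanCover.coverUnits X q then ((lift (χ' ⟨g, h⟩) : Λ) : ℂ) else 0, ?_, ?_, ?_⟩
  · intro γ hγ
    simp only [dif_pos hγ]
    exact (lift _).2
  · intro γ hγ δ hδ
    have hγδ : γ * δ ∈ CartanCover.coverUnits X q := (CartanCover.coverUnits X q).mul_mem hγ hδ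
    simp only [dif_pos hγ, dif_pos hδ, dif_pos hγδ]
    have e2 : χ' ⟨γ * δ, hγδ⟩ = χ' ⟨γ, hγ⟩ + χ' ⟨δ, hδ⟩ := hχ'add ⟨γ, hγ⟩ ⟨δ, hδ⟩
    have e' : Submodule.Quotient.mk (p := p3) (lift (χ' ⟨γ * δ, hγδ⟩))
        = Submodule.Quotient.mk (lift (χ' ⟨γ, hγ⟩) + lift (χ' ⟨δ, hδ⟩)) := by
      rw [Submodule.Quotient.mk_add, hlift, hlift, hlift, e2]
    rw [Submodule.Quotient.eq p3, hp3] at e'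
    obtain ⟨y, hy⟩ := e'
    refine ⟨y, y.2, ?_⟩
    have e3 := congrArg (fun x : Λ => (x : ℂ)) hy
    simp only [Submodule.coe_smul, Submodule.coe_sub, Submodule.coe_add, zsmul_eq_mul, Int.cast_ofNat] at e3
    linear_combination (-1 : ℂ) * e3
  · intro β hβ
    have hβU : β ∈ CartanCover.coverUnits X q :=
      CartanCover.Gamma_le_coverUnits X q (CartanCover.principalLevel_le_Gamma X q hq hβ)
    simp only [dif_pos hβU]
    have e := hχ'res ⟨β, hβU⟩ ((hker ⟨β, hβU⟩).mpr hβ)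
    have e' : Submodule.Quotient.mk (p := p3) (lift (χ' ⟨β, hβU⟩)) = Submodule.Quotient.mk ⟨ψ β, hψΛ β hβ⟩ := by
      rw [hlift, e, hχA ⟨β, hβU⟩ hβ]
    rw [Submodule.Quotient.eq p3, hp3] at e'
    obtain ⟨y, hy⟩ := e'
    refine ⟨y, y.2, ?_⟩
    have e3 := congrArg (fun x : Λ => (x : ℂ)) hy
    simp only [Submodule.coe_smul, Submodule.coe_sub, zsmul_eq_mul, Int.cast_ofNat] at e3
    linear_combination (-1 : ℂ) * e3



end DLSLocal


/-- **(7′) WITHOUT (M0): (EXT) → (OBS) → (DLS).** As `dockedLineSaturation_of_charext`, but the surjectivity of `redHom` onto `SL₂(𝔽_q)` at the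
place `q ≡ 1 (mod 3)` (odd) is now the THEOREM `CoverReduction.redHom_surjective_of_odd` (Kneser's strong approximation, lattice form), so the print
input (M0) `StrongApproxAtCartanPlace` is no longer a hypothesis. [cite: KohenPacetti2016, Rem. 3.8 (arXiv:1403.7801v3 p. 15)] [cite: VignerasLNM800, Ch. III §4 Thm. 4.3] -/
theorem dockedLineSaturation_of_ext_of_noExtension (hE : InvariantHomExtendsSL2)
    (hO : NoModThreePeriodCharacterExtension) : DockedLineSaturation := by
  intro V _ _ h11 hS N D M C q _ X W₁ _ Q hq R hN hDMC hq3 hq3N hcq hQ hq1 v hvc hv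
  obtain ⟨c, hc⟩ := hvc
  have hv' : ∀ γ : CartanCover.coverUnits X q, ∃ w : R.IndCuspForm, w ∈ R.periodLattice Q.L.lattice (R.dockNonsplit hq Q.form) ∧
      R.indRep (R.redHom γ) (v : R.IndCuspForm) - v = w + w + w := by
    intro γ
    obtain ⟨w, hw⟩ := hv (R.redHom γ)
    refine ⟨w, w.2, ?_⟩
    have h3 : ((3 : ℤ) • w : R.periodLattice Q.L.lattice (R.dockNonsplit hq Q.form)) = w + w + w := by
      rw [show (3 : ℤ) = 1 + 1 + 1 by norm_num, add_zsmul, add_zsmul, one_zsmul]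
    rw [h3] at hw
    have e := congrArg (fun x : R.periodLattice Q.L.lattice (R.dockNonsplit hq Q.form) => (x : R.IndCuspForm)) hw
    simpa only [AddSubgroup.coe_sub, AddSubgroup.coe_add, CartanCover.CoverReduction.coe_latticeRep_apply] using e
  have hΛ1 : ∀ β ∈ CartanCover.principalLevel X q, c * segmentIntegral (⇑Q.form) Q.basePoint (β • Q.basePoint) ∈ Q.L.lattice :=
    fun β hβ => smul_period_mem R hq Q c v v.2 hc hβ Q.basePoint
  have hconj : ∀ γ ∈ CartanCover.coverUnits X q, ∀ β ∈ CartanCover.principalLevel X q, ∃ y ∈ Q.L.lattice,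
      c * segmentIntegral (⇑Q.form) Q.basePoint ((γ * β * γ⁻¹) • Q.basePoint)
        - c * segmentIntegral (⇑Q.form) Q.basePoint (β • Q.basePoint) = 3 * y := by
    intro γ hγ β hβ
    obtain ⟨w, hwL, hw⟩ := hv' ⟨γ⁻¹, (CartanCover.coverUnits X q).inv_mem hγ⟩
    have := smul_period_conj_sub R hq Q c v hc ⟨γ⁻¹, (CartanCover.coverUnits X q).inv_mem hγ⟩ w hwL hw hβ
    simpa only [inv_inv] using this
  have hadd : ∀ β₁ ∈ CartanCover.principalLevel X q, ∀ β₂ ∈ CartanCover.principalLevel X q,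
      c * segmentIntegral (⇑Q.form) Q.basePoint ((β₁ * β₂) • Q.basePoint)
        = c * segmentIntegral (⇑Q.form) Q.basePoint (β₁ • Q.basePoint) + c * segmentIntegral (⇑Q.form) Q.basePoint (β₂ • Q.basePoint) := by
    intro β₁ hβ₁ β₂ _
    rw [period_mul_loc Q.form (CartanCover.principalLevel_le_Gamma X q hq hβ₁) β₂ Q.basePoint, mul_add]
  obtain ⟨χ, hχΛ, hχadd, hχres⟩ := exists_modThree_extension_local R
    (fun g hg => R.redHom_surjective_of_odd (by omega) g hg) hE hq hq1 Q.L.lattice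
    (fun g => c * segmentIntegral (⇑Q.form) Q.basePoint (g • Q.basePoint)) hΛ1 hadd hconj
  have hOBS := hO V h11 hS N D M C q X W₁ Q hq hN hDMC hq3 hq3N hcq hQ hq1 c χ hχΛ hχadd hχres
  have hmem := third_smul_mem_periodLattice R hq Q c v v.2 hc hOBS
  refine ⟨⟨(3 : ℂ)⁻¹ • (v : R.IndCuspForm), hmem⟩, Subtype.ext ?_⟩
  rw [AddSubgroupClass.coe_zsmul]
  show (v : R.IndCuspForm) = (3 : ℤ) • ((3 : ℂ)⁻¹ • (v : R.IndCuspForm))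
  rw [← Int.cast_smul_eq_zsmul ℂ, smul_smul]
  norm_num

/-- **(D4) FROM (M) AND (OBS) ONLY.** `CartanCover.SaturationAtThree` follows from the character of the period lattice (M) [print] and the Galois leaf
(OBS): torus pinning (`saturation_of_pinning`, (ZC) `centralCharacterTrivial`, (TFL𝕃) `torusFixedLineLattice_of_character hM`) applied to
`dockedLineSaturation_of_ext_of_noExtension invariantHomExtendsSL2 hOBS` ((EXT) and (M0)-at-odd-places being theorems).
[cite: KohenPacetti2016, Rem. 3.8 (arXiv:1403.7801v3 p. 15)] -/
theorem saturationAtThree_of_character_of_noExtension (hM : CartanCover.PeriodLatticeCharacter)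
    (hOBS : NoModThreePeriodCharacterExtension) : CartanCover.SaturationAtThree :=
  saturation_of_pinning centralCharacterTrivial (torusFixedLineLattice_of_character hM)
    (dockedLineSaturation_of_ext_of_noExtension invariantHomExtendsSL2 hOBS)

end Summit.BirchSwinnertonDyer.BirchSwinnertonDyer.Theorems.CartanCover.Charext

end
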